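import Summits.BirchSwinnertonDyer.BirchSwinnertonDyer.Theorems.ErratumRoadFiveNonSurjCornerAuxPrimeKDisjointPrelims
import Summits.BirchSwinnertonDyer.BirchSwinnertonDyer.Theorems.ErratumRoadFiveNonSurjCornerAuxPrimeKDisjointInertia
import Summits.BirchSwinnertonDyer.BirchSwinnertonDyer.Theorems.ErratumRoadFiveNonSurjCornerFiveImageExact
import Literature.NumberTheory.EllipticCurves.Rank1Residual.X9SplitPrime
import Literature.NumberTheory.GaloisRepresentations.InducedRestrictCompositumBlocks
import Literature.NumberTheory.GaloisRepresentations.FrobeniusPlaces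
import Literature.NumberTheory.GaloisRepresentations.DegreeOnePrimesFixedField
import Literature.NumberTheory.GaloisRepresentations.IntegralGaloisActionProofs
import HarnessLib

/-!
# Route `ErratumRoadFive` (rung K2), crux `NonSurjCorner` (item stmt-BirchSwinnertonDyer-19065), line `Lines/hybrid.lean` r23:
# SLOT 6‴ `stub_cornerKDisjoint57` — K-DISJOINTNESS ON THE CORNER'S INERT FRAMES, PROVED
# (cell `bsd-stepL`, seat `bsd-stepL-corner-p1` g19; `--supports stmt-BirchSwinnertonDyer-19065`)

WHAT. For a (T4′) corner pair (`ClassX11b W p`, `ρ̄_{E,p}` not onto, `p ∈ {5, 7}`) and an imaginary quadratic field `K` in which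
`p` is INERT (`#{𝔭 ∣ p} = 1`) and UNRAMIFIED (`p ∤ d_K`): every value of `ρ̄_{E,p}` on `Γ_ℚ` is already taken on `res Γ_K`
(`ρ̄(Γ_K) = ρ̄(Γ_ℚ)`, i.e. `K ⊄ ℚ(E[p])`). This is the REGISTERED stub `stub_cornerKDisjoint57` of r23 VERBATIM
(`AuxPrimeSupplyCorner.stub_cornerKDisjoint57`, the stub's name and header); with it this seat's `cornerAuxPrimeSupply_of_rangeK` (p656495) gives the corner
Chebotarev–Kummer auxiliary-prime supply, and road B (`…HybridRoadB`, `…HybridKDisjoint` = glue #25) Gross's E′-label at the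
carriers: item 27982 ((B6) at the carriers) has LEFT 19065's cone with no residual.

PROOF (memo CORNER-G18 §6″ step (d), over g18's steps (a)(b)(c)). Suppose some value `ρ̄(σ)` is missed on `H = res Γ_K`
(index `2`, normal). Frame `Φ`; `G' = Φ(ρ̄(Γ_ℚ))`, `M = Φ(ρ̄(H))`, normal in `G'`. At a prime `𝔏 ∣ p` of `ℤ̄`:
`Φ(ρ̄(I_𝔏)) = P₁ (1 0; 0 *) P₁⁻¹ ≤ M` (multiplicative reduction, `p ∤ |image|`, `p ∤ d_K`; step (b), `…AuxPrimeKDisjointInertia`).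
The exact corner image (lane B: `N(C_s)` at `7` and off the octahedral branch at `5` — then `C_s = P₁ (* 0; 0 *) P₁⁻¹` by
Serre's Prop. 14 —, or `P₁ G₉ P₁⁻¹` re-framed ON THE INERTIA FRAME by `ZywinaG9.eq_map_G9_of_halfSplitCartan_le_of_three_dvd`)
contains an element `w` ANTIDIAGONAL in the frame `P₁` (the swap, resp. Zywina's `(0 −1; 1 0)`); conjugating by it swaps the
two half-Cartans, so `P₁ (* 0; 0 *) P₁⁻¹ ≤ M` (`splitCartan_le_of_halfSplitCartan_le_of_isAd_conj`). An arithmetic Frobenius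
`Fr` at `𝔏` normalises `I_𝔏`, hence `Φ(ρ̄ Fr)` normalises the half-Cartan and lies in `P₁ (* 0; 0 *) P₁⁻¹ ≤ M`
(`mem_splitCartan_of_mem_normalizer_halfSplitCartan`); by the index-two pull-back (`mem_of_apply_mem_map_of_index_two`, step (a))
`Fr ∈ res Γ_K` — impossible at the inert `p` (`not_mem_range_absGaloisRestrict_of_inert`, residue degree `2` from `#{𝔭 ∣ p} = 1`
and `e = 1`).
* §1 `splitCartan_le_of_halfSplitCartan_le_of_isAd_conj` (group theory, any field);
* §2 `exists_mem_image_isAd_conj` (an antidiagonal element of the corner image in the inertia frame);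
* §3 `exists_place_inertiaDeg_eq_two` (inert ⇒ residue degree `2`), `apply_mem_splitCartan_of_isArithFrobAt` (Frobenius lands in
  the Cartan of the inertia frame);
* §4 `stub_cornerKDisjoint57` — the registered stub, name and header verbatim.

HONEST FRAMING: FOUR+ONE THEOREMS (no definition, no named fact, no `sorry`); elementary Galois bookkeeping over tree theorems
(lane B corner5-p2's exact images, Serre §2.2 / Prop. 14 files, the tree's Frobenius ∕ inertia API); proves ONE registered stub of
19065's line r23; 19065 is NOT closed (four stubs remain: deep witness, twin-lower supplies, fifteen facts, 2 + 5 names); BSD is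
proved for no curve; T7. Credit: g18 (plan + steps (a)(b)(c)), lane B corner5-p2 g2∕g5 (exact images), -w2 g5 (road B).
References (locators only): [cite: Serre1972, §1.11–1.12, §2.1 a), §2.2 Prop. 14, §2.6] [cite: Zywina2015, §1.3, Thm. 1.4]
[cite: NeukirchANT1999, Ch. I §8 (8.2), §9 (9.2)–(9.4); Ch. III §2 (2.12)].
-/

noncomputable section

set_option autoImplicit false
set_option linter.dupNamespace false -- `Summit.BirchSwinnertonDyer.BirchSwinnertonDyer` (summit = problem), tree-wide

open scoped Classical NumberField MatrixGroups Pointwise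
open WeierstrassCurve NumberField Field IsDedekindDomain Matrix
open Literature.NumberTheory.GaloisRepresentations Literature.NumberTheory.GaloisRepresentations.Serre1972
open Literature.NumberTheory.EllipticCurves Literature.NumberTheory.EllipticCurves.Rank1Residual
open Literature.NumberTheory.EllipticCurves.Zywina2015G9
open Summit.BirchSwinnertonDyer.Rank1Residual Rat.HeightOneSpectrum
open Summit.BirchSwinnertonDyer.BirchSwinnertonDyer.Theorems

namespace Summit.BirchSwinnertonDyer.BirchSwinnertonDyer.Theorems.AuxPrimeSupplyCorner

/-! ### §1. Group theory: one antidiagonal normalising element upgrades a half-Cartan to the Cartan -/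

/-- **A subgroup containing the split half-Cartan `P (1 0; 0 *) P⁻¹` and normalised by ONE element `w` antidiagonal in the frame `P`
contains the split Cartan `P (* 0; 0 *) P⁻¹`**: `w` conjugates `P diag(1,a) P⁻¹` to `P diag(a,1) P⁻¹`, and
`diag(a,b) = diag(a,1) · diag(1,b)` (cf. `CornerShape.splitCartan_le_of_halfSplitCartan_le`, where `w` is taken inside the subgroup).
[cite: Serre1972, §2.1 a), §2.2] -/
theorem splitCartan_le_of_halfSplitCartan_le_of_isAd_conj {F : Type*} [Field F] {H : Subgroup (GL (Fin 2) F)}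
    {P w : GL (Fin 2) F} (hwad : GL2.IsAd ((P⁻¹ * w * P : GL (Fin 2) F) : Matrix (Fin 2) (Fin 2) F))
    (hconj : ∀ h ∈ H, w * h * w⁻¹ ∈ H) (hC : halfSplitCartan P ≤ H) : splitCartan P ≤ H := by
  -- the half-Cartan elements `P diag(1,u) P⁻¹ ∈ H`
  have hd : ∀ u : Fˣ, P * halfDiagonalHom u * P⁻¹ ∈ H := fun u ↦
    hC ⟨halfDiagonalHom u, by rw [← range_halfDiagonalHom]; exact ⟨u, rfl⟩, by
      rw [MulEquiv.coe_toMonoidHom, MulAut.conj_apply]⟩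
  intro g hg
  have hdg : GL2.IsDg ((P⁻¹ * g * P : GL (Fin 2) F) : Matrix (Fin 2) (Fin 2) F) :=
    mem_splitCartan_iff.mp hg
  obtain ⟨ha0, hb0⟩ := hdg.entry_ne_zero (GL2.det_ne_zero _)
  set a : Fˣ := Units.mk0 _ ha0 with ha
  set b : Fˣ := Units.mk0 _ hb0 with hb
  set Q : GL (Fin 2) F := P⁻¹ * w * P with hQ
  -- `P⁻¹ g P = (Q diag(1,a) Q⁻¹) · diag(1,b)`
  have hmat : ((P⁻¹ * g * P : GL (Fin 2) F) : Matrix (Fin 2) (Fin 2) F) =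
      ((Q * halfDiagonalHom a * Q⁻¹ : GL (Fin 2) F) : Matrix (Fin 2) (Fin 2) F) *
        ((halfDiagonalHom b : GL (Fin 2) F) : Matrix (Fin 2) (Fin 2) F) := by
    rw [CornerShape.coe_conj_halfDiagonalHom_of_isAd hwad, coe_halfDiagonalHom, diagonal_mul_diagonal,
      hdg.eq_diagonal]
    congr 1
    ext i
    fin_cases i <;> simp [ha, hb]
  have hkey : (P⁻¹ * g * P : GL (Fin 2) F) = Q * halfDiagonalHom a * Q⁻¹ * halfDiagonalHom b :=
    Units.ext (by rw [hmat, ← Units.val_mul])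
  have hg' : g = w * (P * halfDiagonalHom a * P⁻¹) * w⁻¹ * (P * halfDiagonalHom b * P⁻¹) := by
    have : g = P * (P⁻¹ * g * P) * P⁻¹ := by group
    rw [this, hkey, hQ]; group
  rw [hg']
  exact H.mul_mem (hconj _ (hd a)) (hd b)

/-! ### §2. The corner image contains an element antidiagonal in the inertia frame -/

/-- **An antidiagonal element of the corner image in any frame `P₁` whose split half-Cartan lies in the image.** For a (T4′)
corner pair (`ClassX11b W p`, `ρ̄` not onto, `p ∈ {5,7}`), a frame `(e, Φ)` of `E[p]` and `P₁` with `P₁ (1 0; 0 *) P₁⁻¹ ≤ G' = Φ(ρ̄(Γ_ℚ))`: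
some `w ∈ G'` has `P₁⁻¹ w P₁` antidiagonal. Branches: `G' = N(P (* 0; 0 *) P⁻¹)` (at `7`, and at `5` off `3 ∣ #G'`) — then
`P (* 0; 0 *) P⁻¹ = P₁ (* 0; 0 *) P₁⁻¹` by Serre's Prop. 14 and `w = P₁ (0 1; 1 0) P₁⁻¹`; `G' = P₁ G₉ P₁⁻¹` (at `5`, `3 ∣ #G'`, re-framed
on `P₁`) and `w = P₁ (0 −1; 1 0) P₁⁻¹` (Zywina's third generator). [cite: Serre1972, §2.2 Prop. 14, §2.6] [cite: Zywina2015, §1.3] -/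
theorem exists_mem_image_isAd_conj (W : WeierstrassCurve ℚ) [W.IsElliptic] [W.IsGloballyMinimal] (p : ℕ) [Fact p.Prime]
    (hX : ClassX11b W p) (hns : ¬ Surj W p) (h57 : p = 5 ∨ p = 7)
    (Φ : Multiplicative (AddAut (geomTorsion W p)) ≃* GL (Fin 2) (ZMod p))
    (e : geomTorsion W p ≃+ (Fin 2 → ZMod p))
    (he : ∀ (g : Multiplicative (AddAut (geomTorsion W p))) (x : geomTorsion W p),
      e (Multiplicative.toAdd g x) = ((Φ g : GL (Fin 2) (ZMod p)) : Matrix (Fin 2) (Fin 2) (ZMod p)) *ᵥ e x)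
    {P₁ : GL (Fin 2) (ZMod p)} (hP₁ : halfSplitCartan P₁ ≤ (galoisRepTorsion W p).range.map Φ.toMonoidHom) :
    ∃ w ∈ (galoisRepTorsion W p).range.map Φ.toMonoidHom,
      GL2.IsAd ((P₁⁻¹ * w * P₁ : GL (Fin 2) (ZMod p)) : Matrix (Fin 2) (Fin 2) (ZMod p)) := by
  have hp5 : 5 ≤ p := by rcases h57 with rfl | rfl <;> norm_num
  have hp2 : p ≠ 2 := by omega
  have hirr : Irr W p := hX.2.2.2
  have hmult : Mult W p := hX.2.2.1
  -- the normaliser branch, in any frame `P`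
  have hN : ∀ P : GL (Fin 2) (ZMod p), (galoisRepTorsion W p).range.map Φ.toMonoidHom =
      Subgroup.normalizer (splitCartan P : Set (GL (Fin 2) (ZMod p))) →
      ∃ w ∈ (galoisRepTorsion W p).range.map Φ.toMonoidHom,
        GL2.IsAd ((P₁⁻¹ * w * P₁ : GL (Fin 2) (ZMod p)) : Matrix (Fin 2) (Fin 2) (ZMod p)) := by
    intro P hG
    have hCC : splitCartan P = splitCartan P₁ :=
      eq_splitCartan_of_halfSplitCartan_le_normalizer (splitCartan_mem_cartanSubgroups P) hp5 (hG ▸ hP₁)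
    obtain ⟨A, hA⟩ : ∃ Y : GL (Fin 2) (ZMod p), (Y : Matrix (Fin 2) (Fin 2) (ZMod p)) = !![0, (1 : ZMod p); 1, 0] :=
      ⟨Matrix.GeneralLinearGroup.mkOfDetNeZero _ (by rw [Matrix.det_fin_two_of]; norm_num), rfl⟩
    have hAad : GL2.IsAd ((P₁⁻¹ * (P₁ * A * P₁⁻¹) * P₁ : GL (Fin 2) (ZMod p)) : Matrix (Fin 2) (Fin 2) (ZMod p)) := by
      rw [show P₁⁻¹ * (P₁ * A * P₁⁻¹) * P₁ = A by group]
      exact ⟨by simp [hA], by simp [hA]⟩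
    refine ⟨P₁ * A * P₁⁻¹, ?_, hAad⟩
    rw [hG, hCC, mem_normalizer_splitCartan_iff (exists_units_ne_one hp2)]
    exact Or.inr hAad
  rcases h57 with rfl | rfl
  · by_cases h3 : 3 ∣ Nat.card ((galoisRepTorsion W (5 : ℕ)).range.map Φ.toMonoidHom)
    · -- the octahedral branch: `G' = P₁ G₉ P₁⁻¹` on the frame `P₁` itself
      have hpG : ¬ 5 ∣ Nat.card ((galoisRepTorsion W (5 : ℕ)).range.map Φ.toMonoidHom) :=
        not_dvd_card_of_not_hasSurjectiveModNGaloisRep W (5 : ℕ) Φ e he hirr hns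
      have hG := ZywinaG9.eq_map_G9_of_halfSplitCartan_le_of_three_dvd hpG h3 hP₁
      obtain ⟨-, -, gC, -, ⟨-, -, hCm, -⟩, -, -, hC, -⟩ := ZywinaG9.exists_generators
      simp only [Quad.ofMatrix, Prod.mk.injEq] at hC
      refine ⟨P₁ * gC * P₁⁻¹, ?_, ?_⟩
      · rw [hG]
        exact ⟨gC, hCm, by rw [MulEquiv.coe_toMonoidHom, MulAut.conj_apply]⟩
      · rw [show P₁⁻¹ * (P₁ * gC * P₁⁻¹) * P₁ = gC by group]
        exact ⟨hC.1, hC.2.2.2⟩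
    · obtain ⟨P, hG⟩ :=
        CornerShape.image_eq_normalizer_splitCartan_of_not_three_dvd W 5 Φ e he le_rfl hmult hirr hns h3
      exact hN P hG
  · obtain ⟨P, hG⟩ := CornerShape.image_eq_normalizer_splitCartan W 7 Φ e he le_rfl hmult hirr hns
    exact hN P hG

/-! ### §3. Inert ⇒ residue degree `2`; the Frobenius lands in the Cartan of the inertia frame -/

/-- **An inert unramified rational prime has residue degree `2` in a quadratic field**: if `(p)` has exactly one prime of `𝓞 K`
above it and is unramified, then some (the) place `w ∣ p` of `K` has `f(w|p) = 2` (fundamental identity `#{w ∣ p}·e·f = [K:ℚ]`).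
[cite: NeukirchANT1999, Ch. I §8 Prop. (8.2), §9 (9.2)] -/
theorem exists_place_inertiaDeg_eq_two {K : Type} [Field K] [NumberField K] (hK2 : Module.finrank ℚ K = 2)
    {p : ℕ} {v : HeightOneSpectrum (𝓞 ℚ)} (hv : (primesEquiv v : ℕ) = p)
    (hp1 : ((Ideal.span {(p : ℤ)}).primesOver (𝓞 K)).ncard = 1) (hunr : Algebra.IsUnramifiedIn (𝓞 K) v.asIdeal) :
    ∃ w : HeightOneSpectrum (𝓞 K), w.asIdeal.under (𝓞 ℚ) = v.asIdeal ∧ w.asIdeal.inertiaDeg (𝓞 ℚ) = 2 := by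
  haveI : Algebra.IsQuadraticExtension ℚ K := ⟨hK2⟩
  obtain ⟨w, hw⟩ := P2.RationalDescentPlumbing.exists_under_eq (L := K) v
  have h := natCard_placesOver_mul_inertiaDeg (F := ℚ) (M := K) hunr hw
  rw [natCard_placesOver_eq_ncard, ← P2.RationalDescentPlumbing.primesOver_span_eq_primesOver_asIdeal v hv, hp1,
    one_mul, hK2] at h
  exact ⟨w, by rw [← hw, HeightOneSpectrum.under_asIdeal], h⟩

/-- **An arithmetic Frobenius at `𝔏` lands in the split Cartan of the inertia frame.** If `Φ(ρ̄(I_𝔏)) = P₁ (1 0; 0 *) P₁⁻¹` and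
`σ` is an arithmetic Frobenius at `𝔏` (so `σ • 𝔏 = 𝔏` and `σ` normalises `I_𝔏`), then `Φ(ρ̄ σ)` normalises the half-Cartan, hence lies
in `P₁ (* 0; 0 *) P₁⁻¹` (`mem_splitCartan_of_mem_normalizer_halfSplitCartan`; cf. `stabilizer_le_comap_splitCartan_of_goodOrd` at a good
ordinary prime). [cite: Serre1972, §2.1 a), §2.2] [cite: NeukirchANT1999, Ch. I §9 (9.4)] -/
theorem apply_mem_splitCartan_of_isArithFrobAt (W : WeierstrassCurve ℚ) [W.IsElliptic] (p : ℕ) [Fact p.Prime] (hp2 : p ≠ 2)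
    (Φ : Multiplicative (AddAut (geomTorsion W p)) ≃* GL (Fin 2) (ZMod p))
    {v : HeightOneSpectrum (𝓞 ℚ)} {𝔏 : Ideal (absIntegers (𝓞 ℚ) ℚ)} (h𝔏 : 𝔏 ∈ v.primesAbove)
    {P₁ : GL (Fin 2) (ZMod p)}
    (hI : ((𝔏.inertia (absoluteGaloisGroup ℚ)).map (galoisRepTorsion W p)).map Φ.toMonoidHom = halfSplitCartan P₁)
    {σ : absoluteGaloisGroup ℚ} (hσ : IsArithFrobAt (𝓞 ℚ) σ 𝔏) :
    Φ.toMonoidHom (galoisRepTorsion W p σ) ∈ splitCartan P₁ := by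
  haveI : 𝔏.IsPrime := h𝔏.1
  have hσ𝔏 : σ • 𝔏 = 𝔏 := MulAction.mem_stabilizer_iff.mp hσ.mem_stabilizer
  have hσ𝔏' : σ⁻¹ • 𝔏 = 𝔏 := by rw [inv_smul_eq_iff, hσ𝔏]
  refine mem_splitCartan_of_mem_normalizer_halfSplitCartan (exists_units_ne_one hp2) ?_
  rw [← hI, Subgroup.mem_normalizer_iff]
  intro y
  constructor
  · rintro ⟨x, ⟨τ, hτ, rfl⟩, rfl⟩
    have hτ' : σ * τ * σ⁻¹ ∈ 𝔏.inertia (absoluteGaloisGroup ℚ) := by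
      have h1 := DegreeOnePrimes.conj_mem_inertia_of_mem_inertia_smul
        (G := absoluteGaloisGroup ℚ) (g := σ⁻¹) (Q := 𝔏) (τ := τ) (by rw [hσ𝔏']; exact hτ)
      simpa only [inv_inv] using h1
    refine ⟨galoisRepTorsion W p (σ * τ * σ⁻¹), ⟨σ * τ * σ⁻¹, hτ', rfl⟩, ?_⟩
    simp only [MulEquiv.coe_toMonoidHom, map_mul, map_inv]
  · rintro ⟨x, ⟨τ, hτ, rfl⟩, hx⟩
    have hτ' : σ⁻¹ * τ * σ ∈ 𝔏.inertia (absoluteGaloisGroup ℚ) :=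
      DegreeOnePrimes.conj_mem_inertia_of_mem_inertia_smul
        (G := absoluteGaloisGroup ℚ) (g := σ) (Q := 𝔏) (τ := τ) (by rw [hσ𝔏]; exact hτ)
    refine ⟨galoisRepTorsion W p (σ⁻¹ * τ * σ), ⟨σ⁻¹ * τ * σ, hτ', rfl⟩, ?_⟩
    simp only [MulEquiv.coe_toMonoidHom, map_mul, map_inv] at hx ⊢
    rw [hx]
    group

/-! ### §4. The stub: K-disjointness on the inert frames -/

/-- **r23 slot 6‴ `stub_cornerKDisjoint57`, VERBATIM — K-disjointness on the corner's inert frames.** For a (T4′) corner pair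
`(E, p)` (`ClassX11b W p`, `ρ̄_{E,p}` not onto, `p ∈ {5, 7}`) and an imaginary quadratic `K` with `p` inert (`#{𝔭 ∣ p} = 1`) and
unramified (`p ∤ d_K`): every value of `ρ̄_{E,p}` on `Γ_ℚ` is taken on `res Γ_K` (`K ⊄ ℚ(E[p])`). Proof in the module docstring.
[cite: Serre1972, §2.2 Prop. 14, §2.6] [cite: Zywina2015, §1.3, Thm. 1.4] [cite: NeukirchANT1999, Ch. I §9 (9.2)–(9.4)] -/
theorem stub_cornerKDisjoint57 :
    ∀ (W : WeierstrassCurve ℚ) [W.IsElliptic] [W.IsGloballyMinimal] (p : ℕ) [Fact p.Prime],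
      ClassX11b W p → ¬ Surj W p → (p = 5 ∨ p = 7) →
      ∀ (K : Type) [Field K] [NumberField K], IsImaginaryQuadratic K →
        ((Ideal.span {(p : ℤ)}).primesOver (𝓞 K)).ncard = 1 → ¬ (p : ℤ) ∣ NumberField.discr K →
        ∀ σ : Field.absoluteGaloisGroup ℚ, ∃ τ : Field.absoluteGaloisGroup ℚ,
          τ ∈ (Literature.NumberTheory.GaloisRepresentations.absGaloisRestrict ℚ K).range ∧
            galoisRepTorsion W p τ = galoisRepTorsion W p σ := by
  intro W _ _ p _ hX hns h57 K _ _ hK hp1 hdK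
  by_contra hnot
  push Not at hnot
  obtain ⟨σ, hσ⟩ := hnot
  have hpp : p.Prime := Fact.out
  have hp5 : 5 ≤ p := by rcases h57 with rfl | rfl <;> norm_num
  have hp2 : p ≠ 2 := by omega
  have hirr : Irr W p := hX.2.2.2
  have hmult : Mult W p := hX.2.2.1
  haveI : Algebra.IsQuadraticExtension ℚ K := ⟨hK.1⟩
  set H : Subgroup (absoluteGaloisGroup ℚ) := (absGaloisRestrict ℚ K).range with hHdef
  have hH2 : H.index = 2 :=
    (Literature.NumberTheory.Automorphic.isOpen_range_absGaloisRestrict_and_index_eq_two ℚ K hK.1).2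
  haveI hHn : H.Normal := normal_range_absGaloisRestrict ℚ K
  have hσ' : ∀ τ ∈ H, galoisRepTorsion W p τ ≠ galoisRepTorsion W p σ := hσ
  -- a frame of `E[p]`
  obtain ⟨e, Φ, he, -, -, -, -⟩ := W.exists_frame_galoisRepTorsion_rat p
  have hpG : ¬ p ∣ Nat.card ((galoisRepTorsion W p).range.map Φ.toMonoidHom) :=
    not_dvd_card_of_not_hasSurjectiveModNGaloisRep W p Φ e he hirr hns
  have hMG : (H.map (galoisRepTorsion W p)).map Φ.toMonoidHom ≤ (galoisRepTorsion W p).range.map Φ.toMonoidHom :=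
    Subgroup.map_mono (Subgroup.map_le_range _ H)
  -- the place of `ℚ` at `p`, a prime `𝔏 ∣ p` of `ℤ̄`, the inertia frame `P₁` (step (b))
  set v : HeightOneSpectrum (𝓞 ℚ) := (primesEquiv (R := 𝓞 ℚ)).symm ⟨p, hpp⟩ with hvdef
  have hv' : primesEquiv v = ⟨p, hpp⟩ := Equiv.apply_symm_apply _ _
  have hv : (primesEquiv v : ℕ) = p := congrArg Subtype.val hv'
  obtain ⟨𝔏, h𝔏⟩ := HeightOneSpectrum.primesAbove_nonempty v
  obtain ⟨P₁, hI, hIM⟩ :=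
    exists_halfSplitCartan_le_image_rangeK_of_mult_of_not_dvd_discr W hK p hp2 hmult hdK Φ e he hpG hv h𝔏
  -- an element of the image antidiagonal in the frame `P₁`; it normalises `M = Φ(ρ̄(H))`
  obtain ⟨w, hwG, hwad⟩ := exists_mem_image_isAd_conj W p hX hns h57 Φ e he (hIM.trans hMG)
  obtain ⟨x₀, ⟨γ, rfl⟩, rfl⟩ := hwG
  have hconj : ∀ m ∈ (H.map (galoisRepTorsion W p)).map Φ.toMonoidHom,
      Φ.toMonoidHom (galoisRepTorsion W p γ) * m * (Φ.toMonoidHom (galoisRepTorsion W p γ))⁻¹ ∈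
        (H.map (galoisRepTorsion W p)).map Φ.toMonoidHom := by
    rintro m ⟨x, ⟨η, hη, rfl⟩, rfl⟩
    refine ⟨galoisRepTorsion W p (γ * η * γ⁻¹), ⟨γ * η * γ⁻¹, hHn.conj_mem η hη γ, rfl⟩, ?_⟩
    simp only [MulEquiv.coe_toMonoidHom, map_mul, map_inv]
  -- step (c′): the whole split Cartan of the inertia frame lies in `M`
  have hCM : splitCartan P₁ ≤ (H.map (galoisRepTorsion W p)).map Φ.toMonoidHom :=
    splitCartan_le_of_halfSplitCartan_le_of_isAd_conj hwad hconj hIM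
  -- step (d): an arithmetic Frobenius at `𝔏` lies in that Cartan, hence in `M`, hence in `H`
  obtain ⟨Fr, hFr⟩ := HeightOneSpectrum.exists_isArithFrobAt_of_mem_primesAbove_holds (K := ℚ) (v := v) h𝔏
  have hFrM : Φ.toMonoidHom (galoisRepTorsion W p Fr) ∈ (H.map (galoisRepTorsion W p)).map Φ.toMonoidHom :=
    hCM (apply_mem_splitCartan_of_isArithFrobAt W p hp2 Φ h𝔏 hI hFr)
  have hFrH' : galoisRepTorsion W p Fr ∈ H.map (galoisRepTorsion W p) := by
    obtain ⟨x, hx, hxe⟩ := hFrM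
    exact (Φ.injective hxe) ▸ hx
  have hFrH : Fr ∈ H := mem_of_apply_mem_map_of_index_two (galoisRepTorsion W p) hH2 hσ' hFrH'
  -- contradiction: `p` is inert and unramified in `K`
  have hunr : Algebra.IsUnramifiedIn (𝓞 K) v.asIdeal :=
    P2.RationalDescentPlumbing.isUnramifiedIn_of_not_dvd_discr v (by rw [hv]; exact hdK)
  obtain ⟨w₁, hw₁, hf⟩ := exists_place_inertiaDeg_eq_two hK.1 hv hp1 hunr
  exact not_mem_range_absGaloisRestrict_of_inert hK.1 hunr hw₁ hf h𝔏 hFr hFrH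

end Summit.BirchSwinnertonDyer.BirchSwinnertonDyer.Theorems.AuxPrimeSupplyCorner

end
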